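import Summits.KontsevichZagierPeriods.KontsevichZagierPeriods.Theorems.HurwitzMicroSectorsNormalFormPrincipleM4WeightFourMZVFromLevelTwo
import Summits.KontsevichZagierPeriods.KontsevichZagierPeriods.Theorems.HurwitzMicroSectorsNormalFormPrincipleM4SharedTools
import Summits.KontsevichZagierPeriods.KontsevichZagierPeriods.Theorems.HurwitzMicroSectorsNormalFormPrincipleM4ExistsWordRep4
import Summits.KontsevichZagierPeriods.KontsevichZagierPeriods.Theorems.HurwitzMicroSectorsNormalFormPrincipleM4LogTimesNegZetaThree
import Summits.KontsevichZagierPeriods.KontsevichZagierPeriods.Theorems.HurwitzMicroSectorsNormalFormPrincipleL2W3Carriers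
import Summits.KontsevichZagierPeriods.KontsevichZagierPeriods.Theorems.HurwitzMicroSectorsNormalFormPrincipleL2W3RelationsDilation
import Summits.KontsevichZagierPeriods.KontsevichZagierPeriods.Theorems.HurwitzMicroSectorsNormalFormPrincipleM3KernelRefs
import Summits.KontsevichZagierPeriods.KontsevichZagierPeriods.Theorems.HurwitzMicroSectorsNormalFormPrincipleLevelOneValueZetaRepDim

/-!
# `NormalFormPrinciple` (stmt-KontsevichZagierPeriods-3869), line `SketchIdeator1` —
# leaf `stub_boxRigidity`, layer `M4` kernel: references, values, and the words-level relations

Lead seat c9 (`--supports` the crux). Preparations for the DIMENSION-FOUR KERNEL theorem (the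
analogue of the dimension-three capstone `m3Instances_mem_relations_of_eval_eq_zero`): the two
reference representations with their VALUES —
the `ζ(4)` box `Z4 = [□⁴, 1/(1 − x₀x₁x₂x₃)]` (`zetaValue 4`, `LevelOne.value_zetaRep_dim`) and the
product `C1 × Z3 = [(0,1), dt/(1+t)] × [□³, 1/(1 − xyz)]` (`log 2 · ζ(3)`, Fubini `KZ.IntegralRep.value_prod`
with the values `log 2` and `zetaValue 3`) — and one existence statement delivering carriers of the
words `ab, ac` (on `Δ₂`), `aab, aac` (on `Δ₃`), `aaab, aaac, aabb, abab` (on `Δ₄`) together with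
the seven words-level relations the kernel reductions use: `4[aabb] − [aaab]`, `4[abab] − 3[aaab]`,
`2[ab]·[ab] − 5[aaab]`, `4[ab]·[ac] − 5[aaab]`, `8[ac]·[ac] − 5[aaab]` (`m4_weightFour_mzv_levelTwo`),
`8[aaac] − 7[aaab]` (`m4_rel_dilations4`), `3[aab] − 4[aac]` (`l2w3_relations_dilation`).
References: M. Kontsevich, D. Zagier, *Periods* (2001), §1.1–1.2, §4.1. No definitions are introduced.
-/

noncomputable section

open MeasureTheory Set
open Literature.NumberTheory.Transcendental Literature.NumberTheory.Transcendental.KZ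

namespace Summit.KontsevichZagierPeriods.HurwitzMicroSectors.NormalFormPrinciple.PiBox.M3

/-- **`∫₀¹ dx/(1 + x) = log 2`** over the open unit box of `ℝ¹` (one-fold product measure,
translation, `∫₁² dx/x`). [cite: KontsevichZagier2001, §1.1] -/
theorem m4r4_setIntegral_box_one_div_one_add :
    ∫ x in {x : Fin 1 → ℝ | ∀ i, x i ∈ Set.Ioo (0:ℝ) 1}, 1 / (1 + x 0) = Real.log 2 := by
  -- adapted from the private `m3a_setIntegral_box_one_div_one_add` (…M3KernelRefs)
  rw [Beukers.volume_restrict_cube 1]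
  have h1 := integral_fin_nat_prod_eq_prod (n := 1) (𝕜 := ℝ)
    (μ := fun _ : Fin 1 => (volume : Measure ℝ).restrict (Set.Ioo (0:ℝ) 1))
    (fun (_ : Fin 1) (t : ℝ) => 1 / (1 + t))
  simp only [Fin.prod_univ_one] at h1
  rw [h1, ← integral_Ioc_eq_integral_Ioo, ← intervalIntegral.integral_of_le zero_le_one]
  have h2 := intervalIntegral.integral_comp_add_left (fun t : ℝ => 1 / t) (a := 0) (b := 1) (1:ℝ)
  simp only [add_zero, one_add_one_eq_two] at h2
  rw [h2, integral_one_div_of_pos one_pos two_pos, div_one]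

/-- **The two references of the dimension-four kernel with their values.** The `ζ(4)` box
`Z4 = [□⁴, 1/(1 − x₀x₁x₂x₃)]` of value `zetaValue 4`, and the interval `C1 = [(0,1), 1/(1 + x₀)]`
with the `ζ(3)` box `Z3 = [□³, 1/(1 − x₀x₁x₂)]`, whose product has value `log 2 · zetaValue 3`.
[cite: KontsevichZagier2001, §1.1, §4.1] -/
theorem m4r4_exists_refs :
    ∃ (Z4 : IntegralRep 4) (C1 : IntegralRep 1) (Z3 : IntegralRep 3),
      Z4.domain = {x | ∀ i, x i ∈ Set.Ioo (0:ℝ) 1} ∧ (Z4.integrand = fun x => 1 / (1 - x 0 * x 1 * x 2 * x 3)) ∧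
      Z4.value = zetaValue 4 ∧
      C1.domain = {x | ∀ i, x i ∈ Set.Ioo (0:ℝ) 1} ∧ (C1.integrand = fun x => 1 / (1 + x 0)) ∧
      Z3.domain = {x | ∀ i, x i ∈ Set.Ioo (0:ℝ) 1} ∧ (Z3.integrand = fun x => 1 / (1 - x 0 * x 1 * x 2)) ∧
      (C1.prod Z3).value = Real.log 2 * zetaValue 3 := by
  obtain ⟨Z4, hZ4d, hZ4i⟩ := m4t_exists_minusBox4
  obtain ⟨C1, hC1d, hC1i⟩ := m4b_exists_logBox
  obtain ⟨Z3, -, -, ⟨hZ3d, hZ3i, hZ3v⟩, -, -⟩ := m3k_exists_refs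
  refine ⟨Z4, C1, Z3, hZ4d, hZ4i, ?_, hC1d, hC1i, hZ3d, hZ3i, ?_⟩
  · have h := LevelOne.value_zetaRep_dim (w := 4) (by norm_num) 1 Z4 hZ4d fun x _ => by
      show Z4.integrand x = ((1:ℚ):ℝ) / (1 - ∏ i, x i)
      rw [hZ4i, Fin.prod_univ_four]; push_cast; rfl
    rw [h]; push_cast; rw [one_mul]
  · rw [IntegralRep.value_prod, hZ3v, IntegralRep.value, hC1d, hC1i,
      m4r4_setIntegral_box_one_div_one_add]

/-- **Word carriers and the seven words-level relations used by the kernel reductions.**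
[cite: KontsevichZagier2001, §1.2 rules (1), (2)] -/
theorem m4r4_exists_words (C1 : IntegralRep 1) (hC1d : C1.domain = {x | ∀ i, x i ∈ Set.Ioo (0:ℝ) 1})
    (hC1i : C1.integrand = fun x => 1 / (1 + x 0)) :
    ∃ (AB AC : IntegralRep 2) (AAB AAC : IntegralRep 3) (AAAB AAAC AABB ABAB : IntegralRep 4),
      (AB.domain = {t | 0 < t 1 ∧ t 1 < t 0 ∧ t 0 < 1} ∧ (AB.integrand = fun t => 1 / t 0 * (1 / (1 - t 1)))) ∧ (AC.domain = {t | 0 < t 1 ∧ t 1 < t 0 ∧ t 0 < 1} ∧ (AC.integrand = fun t => 1 / t 0 * (1 / (1 + t 1)))) ∧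
      (AAB.domain = {t | 0 < t 2 ∧ t 2 < t 1 ∧ t 1 < t 0 ∧ t 0 < 1} ∧ (AAB.integrand = fun t => 1 / t 0 * 1 / t 1 * (1 / (1 - t 2)))) ∧
      (AAC.domain = {t | 0 < t 2 ∧ t 2 < t 1 ∧ t 1 < t 0 ∧ t 0 < 1} ∧ (AAC.integrand = fun t => 1 / t 0 * 1 / t 1 * (1 / (1 + t 2)))) ∧
      (AAAB.domain = {t | 0 < t 3 ∧ t 3 < t 2 ∧ t 2 < t 1 ∧ t 1 < t 0 ∧ t 0 < 1} ∧
      (AAAB.integrand = fun t => 1 / t 0 * (1 / t 1) * (1 / t 2) * (1 / (1 - t 3)))) ∧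
      (AAAC.domain = {t | 0 < t 3 ∧ t 3 < t 2 ∧ t 2 < t 1 ∧ t 1 < t 0 ∧ t 0 < 1} ∧
      (AAAC.integrand = fun t => 1 / t 0 * (1 / t 1) * (1 / t 2) * (1 / (1 + t 3)))) ∧
      (AABB.domain = {t | 0 < t 3 ∧ t 3 < t 2 ∧ t 2 < t 1 ∧ t 1 < t 0 ∧ t 0 < 1} ∧
      (AABB.integrand = fun t => 1 / t 0 * (1 / t 1) * (1 / (1 - t 2)) * (1 / (1 - t 3)))) ∧
      (ABAB.domain = {t | 0 < t 3 ∧ t 3 < t 2 ∧ t 2 < t 1 ∧ t 1 < t 0 ∧ t 0 < 1} ∧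
      (ABAB.integrand = fun t => 1 / t 0 * (1 / (1 - t 1)) * (1 / t 2) * (1 / (1 - t 3)))) ∧
      ((4:ℤ) • of AABB - of AAAB ∈ relations) ∧
      ((4:ℤ) • of ABAB - (3:ℤ) • of AAAB ∈ relations) ∧
      ((2:ℤ) • of (AB.prod AB) - (5:ℤ) • of AAAB ∈ relations) ∧
      ((4:ℤ) • of (AB.prod AC) - (5:ℤ) • of AAAB ∈ relations) ∧
      ((8:ℤ) • of (AC.prod AC) - (5:ℤ) • of AAAB ∈ relations) ∧
      ((8:ℤ) • of AAAC - (7:ℤ) • of AAAB ∈ relations) ∧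
      ((3:ℤ) • of AAB - (4:ℤ) • of AAC ∈ relations) := by
  obtain ⟨AB, hABd, hABi⟩ : ∃ T : IntegralRep 2, T.domain = {t | 0 < t 1 ∧ t 1 < t 0 ∧ t 0 < 1} ∧
      (T.integrand = fun t => 1 / t 0 * (1 / (1 - t 1))) :=
    m4t_exists_wordRep2 (fun u => 1 / u) (fun u => 1 / (1 - u)) (Or.inl rfl) (Or.inl rfl)
  obtain ⟨AC, hACd, hACi⟩ : ∃ T : IntegralRep 2, T.domain = {t | 0 < t 1 ∧ t 1 < t 0 ∧ t 0 < 1} ∧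
      (T.integrand = fun t => 1 / t 0 * (1 / (1 + t 1))) :=
    m4t_exists_wordRep2 (fun u => 1 / u) (fun u => 1 / (1 + u)) (Or.inl rfl) (Or.inr rfl)
  obtain ⟨AAB, -, AAC, -, -, -, -, -, -, -, -, -, -, -, -, -, ⟨hAABd, hAABi⟩, -, ⟨hAACd, hAACi⟩, -⟩ :=
    l2w3_carriers
  obtain ⟨AAAB, hAAABd, hAAABi⟩ : ∃ T : IntegralRep 4, T.domain = {t | 0 < t 3 ∧ t 3 < t 2 ∧ t 2 < t 1 ∧ t 1 < t 0 ∧ t 0 < 1} ∧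
      (T.integrand = fun t => 1 / t 0 * (1 / t 1) * (1 / t 2) * (1 / (1 - t 3))) :=
    m4_exists_wordRep4 (fun u => 1 / u) (fun u => 1 / u) (fun u => 1 / u) (fun u => 1 / (1 - u)) (Or.inl rfl) (Or.inl rfl) (Or.inl rfl) (Or.inl rfl)
  obtain ⟨AAAC, hAAACd, hAAACi⟩ : ∃ T : IntegralRep 4, T.domain = {t | 0 < t 3 ∧ t 3 < t 2 ∧ t 2 < t 1 ∧ t 1 < t 0 ∧ t 0 < 1} ∧
      (T.integrand = fun t => 1 / t 0 * (1 / t 1) * (1 / t 2) * (1 / (1 + t 3))) :=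
    m4_exists_wordRep4 (fun u => 1 / u) (fun u => 1 / u) (fun u => 1 / u) (fun u => 1 / (1 + u)) (Or.inl rfl) (Or.inl rfl) (Or.inl rfl) (Or.inr rfl)
  obtain ⟨AABB, hAABBd, hAABBi⟩ : ∃ T : IntegralRep 4, T.domain = {t | 0 < t 3 ∧ t 3 < t 2 ∧ t 2 < t 1 ∧ t 1 < t 0 ∧ t 0 < 1} ∧
      (T.integrand = fun t => 1 / t 0 * (1 / t 1) * (1 / (1 - t 2)) * (1 / (1 - t 3))) :=
    m4_exists_wordRep4 (fun u => 1 / u) (fun u => 1 / u) (fun u => 1 / (1 - u)) (fun u => 1 / (1 - u)) (Or.inl rfl) (Or.inl rfl) (Or.inr (Or.inl rfl)) (Or.inl rfl)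
  obtain ⟨AABC, hAABCd, hAABCi⟩ : ∃ T : IntegralRep 4, T.domain = {t | 0 < t 3 ∧ t 3 < t 2 ∧ t 2 < t 1 ∧ t 1 < t 0 ∧ t 0 < 1} ∧
      (T.integrand = fun t => 1 / t 0 * (1 / t 1) * (1 / (1 - t 2)) * (1 / (1 + t 3))) :=
    m4_exists_wordRep4 (fun u => 1 / u) (fun u => 1 / u) (fun u => 1 / (1 - u)) (fun u => 1 / (1 + u)) (Or.inl rfl) (Or.inl rfl) (Or.inr (Or.inl rfl)) (Or.inr rfl)
  obtain ⟨AACB, hAACBd, hAACBi⟩ : ∃ T : IntegralRep 4, T.domain = {t | 0 < t 3 ∧ t 3 < t 2 ∧ t 2 < t 1 ∧ t 1 < t 0 ∧ t 0 < 1} ∧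
      (T.integrand = fun t => 1 / t 0 * (1 / t 1) * (1 / (1 + t 2)) * (1 / (1 - t 3))) :=
    m4_exists_wordRep4 (fun u => 1 / u) (fun u => 1 / u) (fun u => 1 / (1 + u)) (fun u => 1 / (1 - u)) (Or.inl rfl) (Or.inl rfl) (Or.inr (Or.inr rfl)) (Or.inl rfl)
  obtain ⟨AACC, hAACCd, hAACCi⟩ : ∃ T : IntegralRep 4, T.domain = {t | 0 < t 3 ∧ t 3 < t 2 ∧ t 2 < t 1 ∧ t 1 < t 0 ∧ t 0 < 1} ∧
      (T.integrand = fun t => 1 / t 0 * (1 / t 1) * (1 / (1 + t 2)) * (1 / (1 + t 3))) :=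
    m4_exists_wordRep4 (fun u => 1 / u) (fun u => 1 / u) (fun u => 1 / (1 + u)) (fun u => 1 / (1 + u)) (Or.inl rfl) (Or.inl rfl) (Or.inr (Or.inr rfl)) (Or.inr rfl)
  obtain ⟨ABAB, hABABd, hABABi⟩ : ∃ T : IntegralRep 4, T.domain = {t | 0 < t 3 ∧ t 3 < t 2 ∧ t 2 < t 1 ∧ t 1 < t 0 ∧ t 0 < 1} ∧
      (T.integrand = fun t => 1 / t 0 * (1 / (1 - t 1)) * (1 / t 2) * (1 / (1 - t 3))) :=
    m4_exists_wordRep4 (fun u => 1 / u) (fun u => 1 / (1 - u)) (fun u => 1 / u) (fun u => 1 / (1 - u)) (Or.inl rfl) (Or.inr (Or.inl rfl)) (Or.inl rfl) (Or.inl rfl)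
  obtain ⟨ABAC, hABACd, hABACi⟩ : ∃ T : IntegralRep 4, T.domain = {t | 0 < t 3 ∧ t 3 < t 2 ∧ t 2 < t 1 ∧ t 1 < t 0 ∧ t 0 < 1} ∧
      (T.integrand = fun t => 1 / t 0 * (1 / (1 - t 1)) * (1 / t 2) * (1 / (1 + t 3))) :=
    m4_exists_wordRep4 (fun u => 1 / u) (fun u => 1 / (1 - u)) (fun u => 1 / u) (fun u => 1 / (1 + u)) (Or.inl rfl) (Or.inr (Or.inl rfl)) (Or.inl rfl) (Or.inr rfl)
  obtain ⟨ACAB, hACABd, hACABi⟩ : ∃ T : IntegralRep 4, T.domain = {t | 0 < t 3 ∧ t 3 < t 2 ∧ t 2 < t 1 ∧ t 1 < t 0 ∧ t 0 < 1} ∧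
      (T.integrand = fun t => 1 / t 0 * (1 / (1 + t 1)) * (1 / t 2) * (1 / (1 - t 3))) :=
    m4_exists_wordRep4 (fun u => 1 / u) (fun u => 1 / (1 + u)) (fun u => 1 / u) (fun u => 1 / (1 - u)) (Or.inl rfl) (Or.inr (Or.inr rfl)) (Or.inl rfl) (Or.inl rfl)
  obtain ⟨ACAC, hACACd, hACACi⟩ : ∃ T : IntegralRep 4, T.domain = {t | 0 < t 3 ∧ t 3 < t 2 ∧ t 2 < t 1 ∧ t 1 < t 0 ∧ t 0 < 1} ∧
      (T.integrand = fun t => 1 / t 0 * (1 / (1 + t 1)) * (1 / t 2) * (1 / (1 + t 3))) :=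
    m4_exists_wordRep4 (fun u => 1 / u) (fun u => 1 / (1 + u)) (fun u => 1 / u) (fun u => 1 / (1 + u)) (Or.inl rfl) (Or.inr (Or.inr rfl)) (Or.inl rfl) (Or.inr rfl)
  obtain ⟨CAAB, hCAABd, hCAABi⟩ : ∃ T : IntegralRep 4, T.domain = {t | 0 < t 3 ∧ t 3 < t 2 ∧ t 2 < t 1 ∧ t 1 < t 0 ∧ t 0 < 1} ∧
      (T.integrand = fun t => 1 / (1 + t 0) * (1 / t 1) * (1 / t 2) * (1 / (1 - t 3))) :=
    m4_exists_wordRep4 (fun u => 1 / (1 + u)) (fun u => 1 / u) (fun u => 1 / u) (fun u => 1 / (1 - u)) (Or.inr rfl) (Or.inl rfl) (Or.inl rfl) (Or.inl rfl)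
  obtain ⟨CAAC, hCAACd, hCAACi⟩ : ∃ T : IntegralRep 4, T.domain = {t | 0 < t 3 ∧ t 3 < t 2 ∧ t 2 < t 1 ∧ t 1 < t 0 ∧ t 0 < 1} ∧
      (T.integrand = fun t => 1 / (1 + t 0) * (1 / t 1) * (1 / t 2) * (1 / (1 + t 3))) :=
    m4_exists_wordRep4 (fun u => 1 / (1 + u)) (fun u => 1 / u) (fun u => 1 / u) (fun u => 1 / (1 + u)) (Or.inr rfl) (Or.inl rfl) (Or.inl rfl) (Or.inr rfl)
  obtain ⟨k1, k2, k3, k4, k5⟩ := m4_weightFour_mzv_levelTwo C1 hC1d hC1i AB hABd hABi AC hACd hACi AAB hAABd hAABi AAC hAACd hAACi AAAB hAAABd hAAABi AAAC hAAACd hAAACi AABB hAABBd hAABBi AABC hAABCd hAABCi AACB hAACBd hAACBi AACC hAACCd hAACCi ABAB hABABd hABABi ABAC hABACd hABACi ACAB hACABd hACABi ACAC hACACd hACACi CAAB hCAABd hCAABi CAAC hCAACd hCAACi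
  obtain ⟨d1, -, -⟩ := m4_rel_dilations4 AAAB hAAABd hAAABi AAAC hAAACd hAAACi AABB hAABBd hAABBi AABC hAABCd hAABCi AACB hAACBd hAACBi AACC hAACCd hAACCi ABAB hABABd hABABi ABAC hABACd hABACi ACAB hACABd hACABi ACAC hACACd hACACi
  have r1 : (3:ℤ) • of AAB - (4:ℤ) • of AAC ∈ relations :=
    l2w3_relations_dilation.1 AAB hAABd hAABi AAC hAACd hAACi
  exact ⟨AB, AC, AAB, AAC, AAAB, AAAC, AABB, ABAB, ⟨hABd, hABi⟩, ⟨hACd, hACi⟩, ⟨hAABd, hAABi⟩,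
    ⟨hAACd, hAACi⟩, ⟨hAAABd, hAAABi⟩, ⟨hAAACd, hAAACi⟩, ⟨hAABBd, hAABBi⟩, ⟨hABABd, hABABi⟩,
    k1, k2, k3, k4, k5, d1, r1⟩

end Summit.KontsevichZagierPeriods.HurwitzMicroSectors.NormalFormPrinciple.PiBox.M3
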